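import Summits.ResolutionOfSingularities.ResolutionOfSingularities.Theorems.WeightedInvariantE2SpanFiltration
import Literature.AlgebraicGeometry.Resolution.StrictNormalCrossingsAt
import HarnessLib

/-!
# E2 centre, (G-0-U) `E2HomogeneousSpanBody`, part 1b: the RE-PRESENTATION CRITERION for weighted filtrations and the
# one-generator EXCHANGE STEP (graded-free local algebra)

[OURS · L1 W4.3 · DOOR `HypersurfaceCentreConstruction` stmt-ResolutionOfSingularities-19897 · E2 tier, centre piece
(C-c), hand (G-0-U) = board (o47-c-U) `E2HomogeneousSpanBody p ι J` of registrar res-L1-w43-plan-1's SPEC (Δ11)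
(`L/res-L1-w43-plan-1/E2Step_split_sketch.lean` rev 9/10 l.718), DEAL 19:50:17Z → res-D-pv-031 (gen 11).  Pure commutative
algebra; nothing here is a statement of the manuscript under adjudication [Hironaka2017]; candidate-design support, AI-written,
weaker than expert review.]

* `ideal_eq_of_repr` — **RE-PRESENTATION CRITERION** (Noetherian local `S`, all `uᵢ ∈ 𝔫`, positive weights): if
  `u'ₖ ∈ 𝒥_{w'ₖ}(u, w)` and `uₗ ∈ (u'ₖ : w'ₖ = wₗ) + 𝒥_{wₗ+1} + Σ_{wⱼ < wₗ} uⱼ 𝒥_{wₗ - wⱼ}` for all `k, l`, then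
  `𝒥ₙ(u', w') = 𝒥ₙ(u, w)` for EVERY `n` (induction `𝒥ᵥ ≤ 𝒥'ᵥ + 𝒥ᵥ₊₁`, the tail, Nakayama).
* `exists_update_eq` — **EXCHANGE STEP**: `u : ι → 𝔫` cotangent-independent, `l` an index and finitely many CANDIDATES
  `c g ∈ 𝒥_{wₗ}` with `Σ c g = uₗ`; then for SOME `g` the family `u[l ↦ c g]` has the same weighted filtration in every degree and
  is again cotangent-independent.  (Part 2 takes the homogeneous components of `uₗ` as candidates — route (U-b) of the registrar.)
-/

set_option linter.dupNamespace false -- mandated namespace of this single-conjunct summit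

noncomputable section

open IsLocalRing Literature.AlgebraicGeometry.Resolution

namespace Summit.ResolutionOfSingularities.ResolutionOfSingularities.Cruxes.HypersurfaceCentreConstruction.LocalEngine

namespace E2Span

universe u v

/-! ## §2 The re-presentation criterion -/

section Criterion

variable {S : Type u} [CommRing S] [IsLocalRing S] [IsNoetherianRing S]
  {ι : Type v} {ι' : Type*} (u : ι → S) (w : ι → ℕ) (u' : ι' → S) (w' : ι' → ℕ)

/-- **RE-PRESENTATION CRITERION.**  Let `S` be Noetherian local, `u : ι → 𝔫` (`ι` finite) with positive weights `w`, and
`u' : ι' → S` with weights `w'`.  Suppose (H1) `u'ₖ ∈ 𝒥_{w'ₖ}(u, w)` for every `k`, and (H2) for every `l`,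
`uₗ ∈ (u'ₖ : w'ₖ = wₗ) + 𝒥_{wₗ+1}(u, w) + Σ_{wⱼ < wₗ} uⱼ · 𝒥_{wₗ - wⱼ}(u, w)`.  Then the two weighted filtrations coincide:
`𝒥ₙ(u', w') = 𝒥ₙ(u, w)` for every `n`.  Proof: `𝒥ᵥ ≤ 𝒥'ᵥ + 𝒥ᵥ₊₁` by strong induction on `v` via the first-factor
decomposition, whence `𝒥ᵥ ≤ 𝒥'ᵥ + 𝒥_{v+m} ≤ 𝒥'ᵥ + 𝔫 𝒥ᵥ` for `m ≥ max w`, and Nakayama. [OURS · folklore bookkeeping] -/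
theorem ideal_eq_of_repr [Finite ι] (hw : ∀ i, 1 ≤ w i) (hu : ∀ i, u i ∈ maximalIdeal S)
    (h1 : ∀ k, u' k ∈ (weightedFiltration u w).ideal (w' k))
    (h2 : ∀ l, u l ∈ Ideal.span (u' '' {k | w' k = w l}) ⊔ ((weightedFiltration u w).ideal (w l + 1) ⊔
      ⨆ (j : ι) (_ : w j < w l), Ideal.span {u j} * (weightedFiltration u w).ideal (w l - w j)))
    (n : ℕ) : (weightedFiltration u' w').ideal n = (weightedFiltration u w).ideal n := by
  set F := weightedFiltration u w with hF
  set F' := weightedFiltration u' w' with hF'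
  have hle' : ∀ n, F'.ideal n ≤ F.ideal n := ideal_le_of_forall_mem u w u' w' h1
  have hspan : ∀ i, Ideal.span {u i} ≤ F.ideal (w i) := fun i =>
    (Ideal.span_singleton_le_iff_mem _).mpr (mem_weightedFiltration_ideal u w i)
  -- the key estimate
  have key : ∀ v, F.ideal v ≤ F'.ideal v ⊔ F.ideal (v + 1) := by
    intro v
    induction v using Nat.strong_induction_on with
    | _ v ih =>
    rcases Nat.eq_zero_or_pos v with rfl | hv
    · rw [F'.ideal_zero]; exact le_sup_left.trans' le_top
    have hprod : ∀ a b, 1 ≤ a → 1 ≤ b → a + b = v →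
        F.ideal a * F.ideal b ≤ F'.ideal v ⊔ F.ideal (v + 1) := by
      intro a b ha hb hab
      calc F.ideal a * F.ideal b
          ≤ (F'.ideal a ⊔ F.ideal (a + 1)) * (F'.ideal b ⊔ F.ideal (b + 1)) :=
            Ideal.mul_mono (ih a (by omega)) (ih b (by omega))
        _ ≤ F'.ideal v ⊔ F.ideal (v + 1) := by
            rw [Ideal.sup_mul, Ideal.mul_sup, Ideal.mul_sup]
            refine sup_le (sup_le ?_ ?_) (sup_le ?_ ?_)
            · exact le_sup_left.trans' ((F'.mul_le a b).trans (by rw [hab]))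
            · exact le_sup_right.trans'
                ((Ideal.mul_mono_left (hle' a)).trans ((F.mul_le _ _).trans (F.antitone (by omega))))
            · exact le_sup_right.trans'
                ((Ideal.mul_mono_right (hle' b)).trans ((F.mul_le _ _).trans (F.antitone (by omega))))
            · exact le_sup_right.trans' ((F.mul_le _ _).trans (F.antitone (by omega)))
    rw [ideal_eq_iSup_span_mul u w hv]
    refine iSup_le fun i => ?_
    rcases lt_trichotomy (w i) v with hlt | heq | hgt
    · exact (Ideal.mul_mono_left (hspan i)).trans (hprod _ _ (hw i) (by omega) (by omega))
    · have h0 : F.ideal (v - w i) = ⊤ := by rw [heq, Nat.sub_self, F.ideal_zero]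
      rw [h0, Ideal.mul_top, Ideal.span_singleton_le_iff_mem]
      have h2i := h2 i
      rw [heq] at h2i
      refine (sup_le ?_ (sup_le le_sup_right ?_) : _ ≤ F'.ideal v ⊔ F.ideal (v + 1)) h2i
      · refine le_sup_left.trans' (Ideal.span_le.mpr ?_)
        rintro _ ⟨k, hk, rfl⟩
        have hk' : w' k = v := hk
        exact hk' ▸ mem_weightedFiltration_ideal u' w' k
      · refine iSup₂_le fun j hj => ?_
        exact (Ideal.mul_mono_left (hspan j)).trans (hprod _ _ (hw j) (by omega) (by omega))
    · have h0 : F.ideal (v - w i) = ⊤ := by rw [Nat.sub_eq_zero_of_le hgt.le, F.ideal_zero]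
      rw [h0, Ideal.mul_top]
      exact le_sup_right.trans' ((hspan i).trans (F.antitone (by omega)))
  -- iterate the key estimate
  have key' : ∀ v m, F.ideal v ≤ F'.ideal v ⊔ F.ideal (v + m) := by
    intro v m
    induction m with
    | zero => exact le_sup_right
    | succ m ihm =>
      refine ihm.trans (sup_le le_sup_left ((key (v + m)).trans (sup_le ?_ ?_)))
      · exact le_sup_left.trans' (F'.antitone (by omega))
      · exact le_sup_right.trans' (F.antitone (by omega))
  -- the tail and Nakayama
  rcases Nat.eq_zero_or_pos n with rfl | hn
  · rw [F.ideal_zero, F'.ideal_zero]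
  obtain ⟨m, hm⟩ := (Set.finite_range w).bddAbove
  have hm' : ∀ i, w i ≤ m := fun i => hm ⟨i, rfl⟩
  refine le_antisymm (hle' n) ?_
  have htail : F.ideal (n + m) ≤ maximalIdeal S * F.ideal n :=
    (ideal_add_le_span_mul u w hm' (by omega)).trans
      (Ideal.mul_mono_left (Ideal.span_le.mpr (Set.range_subset_iff.mpr hu)))
  have hN : F.ideal n ≤ F'.ideal n ⊔ maximalIdeal S • F.ideal n :=
    (key' n m).trans (sup_le le_sup_left (le_sup_right.trans' htail))
  exact Submodule.le_of_le_smul_of_le_jacobson_bot (IsNoetherian.noetherian _)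
    (by rw [IsLocalRing.jacobson_eq_maximalIdeal ⊥ bot_ne_top]) hN

end Criterion

/-! ## §3 The exchange step -/

section Exchange

variable {S : Type u} [CommRing S] [IsLocalRing S] [IsNoetherianRing S]
  {ι : Type v} [Fintype ι] [DecidableEq ι] (u : ι → S) (w : ι → ℕ)

/-- **EXCHANGE STEP.**  `S` Noetherian local, `u : ι → 𝔫` with positive weights and linearly independent images in `𝔫/𝔫²`,
`l` an index, and finitely many CANDIDATES `c g ∈ 𝒥_{wₗ}(u, w)` summing to `uₗ`.  Then for some candidate `c g` the family
`u[l ↦ c g]` has the same weighted filtration as `u` in every degree and is again cotangent-independent.  Mechanism: write each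
candidate along `𝒥_{wₗ} = (uₖ : wₖ = wₗ) + remainder`; summing, the coefficients of `uₗ` add up to `1` modulo `𝔫` (independence
in `𝔫/𝔫²`, `remainder ⊆ (uₖ : wₖ > wₗ) + 𝔫²`), so one of them is a unit — that candidate satisfies the re-presentation
criterion §2 and replaces `uₗ` in the cotangent basis. [OURS · folklore bookkeeping] -/
theorem exists_update_eq (hw : ∀ i, 1 ≤ w i) (hu : ∀ i, u i ∈ maximalIdeal S)
    (hli : LinearIndependent (ResidueField S) (fun i => (maximalIdeal S).toCotangent ⟨u i, hu i⟩))
    (l : ι) {γ : Type*} [Fintype γ] (c : γ → S) (hc : ∀ g, c g ∈ (weightedFiltration u w).ideal (w l))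
    (hsum : ∑ g, c g = u l) :
    ∃ g, (∀ n, (weightedFiltration (Function.update u l (c g)) w).ideal n = (weightedFiltration u w).ideal n) ∧
      ∃ hu' : ∀ i, Function.update u l (c g) i ∈ maximalIdeal S,
        LinearIndependent (ResidueField S)
          (fun i => (maximalIdeal S).toCotangent ⟨Function.update u l (c g) i, hu' i⟩) := by
  classical
  set F := weightedFiltration u w with hF
  set D : Ideal S := F.ideal (w l + 1) ⊔
    ⨆ (j : ι) (_ : w j < w l), Ideal.span {u j} * F.ideal (w l - w j) with hD
  have T2 := (linearIndependent_toCotangent_iff_forall_mem u hu).mp hli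
  have hPn : Ideal.span (Set.range u) ≤ maximalIdeal S := Ideal.span_le.mpr (Set.range_subset_iff.mpr hu)
  have hsq : Ideal.span (Set.range u) ^ 2 ≤ maximalIdeal S ^ 2 := Ideal.pow_right_mono hPn 2
  have hF1 : F.ideal (w l) ≤ Ideal.span (u '' {k | w k = w l}) ⊔ D :=
    ideal_le_span_image_sup_remainder u w (hw l)
  have hF2 : D ≤ Ideal.span (u '' {k | w l < w k}) ⊔ maximalIdeal S ^ 2 :=
    (remainder_le_span_image_sup_sq u w (w l)).trans (sup_le_sup_left hsq _)
  -- decompose every candidate along `(uₖ : wₖ = wₗ) + D`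
  have hdec : ∀ g, ∃ b : ι → S, (∀ k, ¬ (w k = w l) → b k = 0) ∧ c g - ∑ k, b k * u k ∈ D := by
    intro g
    obtain ⟨y, hy, d, hd, hyd⟩ := Submodule.mem_sup.mp (hF1 (hc g))
    obtain ⟨b, hb0, rfl⟩ := exists_fun_of_mem_span_image u hy
    exact ⟨b, hb0, by rw [← hyd, add_sub_cancel_left]; exact hd⟩
  choose b hb0 hbD using hdec
  -- one candidate has a unit coefficient at `l`
  have hunit : ∃ g, b g l ∉ maximalIdeal S := by
    by_contra hall
    push Not at hall
    have hz : u l - ∑ k, (∑ g, b g k) * u k ∈ D := by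
      have e : u l - ∑ k, (∑ g, b g k) * u k = ∑ g, (c g - ∑ k, b g k * u k) := by
        rw [Finset.sum_sub_distrib, hsum, Finset.sum_comm]
        simp only [Finset.sum_mul]
      rw [e]
      exact Ideal.sum_mem _ fun g _ => hbD g
    obtain ⟨y, hy, n, hn, hyn⟩ := Submodule.mem_sup.mp (hF2 hz)
    obtain ⟨t, ht0, rfl⟩ := exists_fun_of_mem_span_image u hy
    have hrel : ∑ k, ((if k = l then 1 else 0) - (∑ g, b g k) - t k) * u k ∈ maximalIdeal S ^ 2 := by
      have e : ∑ k, ((if k = l then 1 else 0) - (∑ g, b g k) - t k) * u k =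
          (u l - ∑ k, (∑ g, b g k) * u k) - ∑ k, t k * u k := by
        simp only [sub_mul, Finset.sum_sub_distrib, ite_mul, one_mul, zero_mul, Finset.sum_ite_eq',
          Finset.mem_univ, if_true]
      rw [e, ← hyn, add_sub_cancel_left]
      exact hn
    have hl := T2 _ hrel l
    rw [if_pos rfl, ht0 l (lt_irrefl _), sub_zero] at hl
    have h1 : (1 : S) ∈ maximalIdeal S := by
      have := Ideal.add_mem _ hl (Ideal.sum_mem _ fun g (_ : g ∈ Finset.univ) => hall g)
      rwa [sub_add_cancel] at this
    exact (IsLocalRing.maximalIdeal.isMaximal S).ne_top ((Ideal.eq_top_iff_one _).mpr h1)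
  obtain ⟨g, hg⟩ := hunit
  have hbu : IsUnit (b g l) := IsLocalRing.notMem_maximalIdeal.mp hg
  set u' := Function.update u l (c g) with hu'def
  have hu'l : u' l = c g := Function.update_self l (c g) u
  have hu'k : ∀ k, k ≠ l → u' k = u k := fun k hk => Function.update_of_ne hk (c g) u
  have hu' : ∀ i, u' i ∈ maximalIdeal S := by
    intro i
    by_cases hi : i = l
    · rw [hi, hu'l]; exact hPn (ideal_le_span u w (hw l) (hc g))
    · rw [hu'k i hi]; exact hu i
  refine ⟨g, ?_, hu', ?_⟩
  · -- same filtration: the re-presentation criterion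
    apply ideal_eq_of_repr u w u' w hw hu
    · intro k
      by_cases hk : k = l
      · rw [hk, hu'l]; exact hc g
      · rw [hu'k k hk]; exact mem_weightedFiltration_ideal u w k
    · intro k
      by_cases hk : k = l
      · subst hk
        -- `b g k • u k = c g - Σ_{k' ≠ k} b g k' u k' - (c g - Σ b g k' u k') ∈ (u'ₖ' : wₖ' = wₖ) + D`
        have h1 : c g ∈ Ideal.span (u' '' {k' | w k' = w k}) := Ideal.subset_span ⟨k, rfl, hu'l⟩
        have h2 : ∑ k' ∈ Finset.univ.erase k, b g k' * u k' ∈ Ideal.span (u' '' {k' | w k' = w k}) := by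
          refine Ideal.sum_mem _ fun k' hk' => ?_
          have hne : k' ≠ k := Finset.ne_of_mem_erase hk'
          by_cases hw' : w k' = w k
          · exact Ideal.mul_mem_left _ _ (Ideal.subset_span ⟨k', hw', hu'k k' hne⟩)
          · rw [hb0 g k' hw', zero_mul]; exact Ideal.zero_mem _
        have h3 : b g k * u k = c g - ∑ k' ∈ Finset.univ.erase k, b g k' * u k' - (c g - ∑ k', b g k' * u k') := by
          rw [← Finset.add_sum_erase _ _ (Finset.mem_univ k)]; ring
        have h4 : b g k * u k ∈ Ideal.span (u' '' {k' | w k' = w k}) ⊔ D := by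
          rw [h3]
          exact Ideal.sub_mem _ (Ideal.sub_mem _ (Ideal.mem_sup_left h1) (Ideal.mem_sup_left h2))
            (Ideal.mem_sup_right (hbD g))
        have h5 := Ideal.mul_mem_left _ (↑(hbu.unit⁻¹) : S) h4
        rwa [← mul_assoc, IsUnit.val_inv_mul, one_mul] at h5
      · exact Ideal.mem_sup_left (Ideal.subset_span ⟨k, rfl, hu'k k hk⟩)
  · -- cotangent independence of the exchanged family
    refine (linearIndependent_toCotangent_iff_forall_mem u' hu').mpr fun e he => ?_
    -- combined representation `c g = Σ β k u k + n`, `β l = b g l`, `n ∈ 𝔫²`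
    obtain ⟨y, hy, n, hn, hyn⟩ := Submodule.mem_sup.mp (hF2 (hbD g))
    obtain ⟨t, ht0, rfl⟩ := exists_fun_of_mem_span_image u hy
    have hcg : c g = ∑ k, (b g k + t k) * u k + n := by
      have : c g = (c g - ∑ k, b g k * u k) + ∑ k, b g k * u k := by ring
      rw [this, ← hyn]
      simp only [add_mul, Finset.sum_add_distrib]
      ring
    have htl : t l = 0 := ht0 l (lt_irrefl _)
    -- rewrite the relation in terms of `u`
    have hsum' : ∑ k, e k * u' k = ∑ k, (e l * (b g k + t k) + if k = l then 0 else e k) * u k + e l * n := by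
      have e1 : ∑ k, e k * u' k = e l * c g + ∑ k, (if k = l then 0 else e k) * u k := by
        have h1 : ∑ k, e k * u' k = e l * u' l + ∑ k ∈ Finset.univ.erase l, e k * u' k :=
          (Finset.add_sum_erase _ (fun k => e k * u' k) (Finset.mem_univ l)).symm
        have h2 : ∑ k, (if k = l then 0 else e k) * u k =
            (if l = l then 0 else e l) * u l + ∑ k ∈ Finset.univ.erase l, (if k = l then 0 else e k) * u k :=
          (Finset.add_sum_erase _ (fun k => (if k = l then 0 else e k) * u k) (Finset.mem_univ l)).symm
        rw [h1, h2, if_pos rfl, zero_mul, zero_add, hu'l]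
        congr 1
        exact Finset.sum_congr rfl fun k hk => by
          rw [hu'k k (Finset.ne_of_mem_erase hk), if_neg (Finset.ne_of_mem_erase hk)]
      rw [e1, hcg, mul_add, Finset.mul_sum]
      simp only [add_mul, Finset.sum_add_distrib, mul_assoc]
      ring
    have hrel : ∑ k, (e l * (b g k + t k) + if k = l then 0 else e k) * u k ∈ maximalIdeal S ^ 2 := by
      have : ∑ k, (e l * (b g k + t k) + if k = l then 0 else e k) * u k = ∑ k, e k * u' k - e l * n := by
        rw [hsum', add_sub_cancel_right]
      rw [this]
      exact Ideal.sub_mem _ he (Ideal.mul_mem_left _ _ hn)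
    have hT := T2 _ hrel
    have hel : e l ∈ maximalIdeal S := by
      have := hT l
      rw [if_pos rfl, add_zero, htl, add_zero] at this
      exact ((IsLocalRing.maximalIdeal.isMaximal S).isPrime.mem_or_mem this).resolve_right hg
    intro i
    by_cases hi : i = l
    · rw [hi]; exact hel
    · have := hT i
      rw [if_neg hi] at this
      have h' : e i = (e l * (b g i + t i) + e i) - e l * (b g i + t i) := by ring
      rw [h']
      exact Ideal.sub_mem _ this (Ideal.mul_mem_right _ _ hel)

end Exchange

end E2Span

end Summit.ResolutionOfSingularities.ResolutionOfSingularities.Cruxes.HypersurfaceCentreConstruction.LocalEngine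

end
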